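import Literature.Topology.PlaneTopology.Rectangles
import Literature.Topology.PlaneTopology.JordanLoopSides
import Mathlib.Analysis.Convex.Topology
import HarnessLib

/-!
# The three-chamber configuration at a boundary point (Lawler–Schramm–Werner, Lemma 5.4): set-up

Topic: Analysis / Complex. First file of the tree's rendering of the geometric core of
G. F. Lawler, O. Schramm, W. Werner, *Conformal invariance of planar loop-erased random walks and
uniform spanning trees*, Ann. Probab. **32** (2004), proof of Lemma 5.4 ("Let `z₁` be a point in
`∂D` closest to `w` … Let `A₁` be the line segment `[w, z₁]` … `A₂` and `A₃` the two connected
components of `Q ∖ {w}` … `K_j` the connected component of `D ∖ (A₁ ∪ A₂ ∪ A₃)` which does not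
have `A_j` as a subset of its boundary"), in an AXIS-ALIGNED normalisation suited to lattice
random walks: the boundary point is `z₁ = 0 ∉ Ω`, the interior point is `x = r + a i` with
`0 ≤ a ≤ r`, the open square of centre `x` and half-side `r` lies in `Ω` (so `x` is at
sup-distance `r` from `∂Ω`, attained at `0`), and the circle `Q` of [LSW04] is replaced by the
boundary of the square `Q' = (-r, r)²` of centre `0`, on which `x` lies.

This file fixes the data (`Setup`: the domain `Ω`, a conformal map `F : 𝔻 → Ω` continuous on
the closed disc with inverse `ψ`, and `r, a`) and the elementary geometry:

* `sqn` (the sup-norm), `Setup.side` (the signed area form `r · im z - a · re z`, positive to the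
  left of the ray `0 → x`), the near ball `B₀ = B(x, 9r/10)`, the gate set
  `G = [0, x] ∪ ∂Q'`, and the three launch regions `V 0 = B₀ ∩ {re > r}`,
  `V 1 = B₀ ∩ Q' ∩ {side < 0}`, `V 2 = B₀ ∩ Q' ∩ {side > 0}` (`Setup.V`);
* the boundary loop `σ` of `Q'` based at `x`, run counter-clockwise (`Setup.sqLoop`, a shift of
  the boundary loop of `PlaneTopology.rect`): a Jordan loop with range `∂Q' = {sqn = r}` and
  inside `Q'`, with `σ 0 = x`, whose points just after `x` have `side > 0` and just before `x`
  have `side < 0`;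
* **`∂Q' ⊄ Ω`** (`Setup.exists_sqLoop_notMem`): otherwise the loop winds around `0 ∉ Ω` inside
  the conformal disc `Ω` (`wind_sub_eq_zero_of_leftInvOn`);
* the first exits `τ₊ ∈ (0, 1]`, `τ₋ ∈ [-1, 0)` of `σ` from `Ω` after and before `x`
  (`Setup.tauP`, `Setup.tauM`), with `σ [0, τ₊) ∪ σ (τ₋, 0] ⊆ Ω`, `σ τ± ∉ Ω`, `τ₊ - τ₋ ≤ 1`;
  these arcs are the gates `A₂`, `A₃` of [LSW04], the gate `A₁` being the segment `(0, x]`.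

Everything here is proved; the chamber lemma itself is in `ThreeChamberLemma.lean`.

## References

* G. F. Lawler, O. Schramm, W. Werner, Ann. Probab. 32 (2004), proof of Lemma 5.4.
  [LawlerSchrammWerner2004]
-/

noncomputable section

open Set Filter Metric Function Complex
open _root_.Topology
open Literature.Topology.PlaneTopology
open Literature.Probability.RandomPlanarGeometry (JordanDomain)

namespace Literature.Analysis.Complex

namespace ThreeChamber

/-! ### The sup-norm -/

/-- The sup-norm `max |re z| |im z|`. [folklore] -/
def sqn (z : ℂ) : ℝ := max |z.re| |z.im|

/-- `sqn` is continuous. [folklore] -/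
@[fun_prop] theorem continuous_sqn : Continuous sqn := by unfold sqn; fun_prop

/-- `sqn z ≤ ‖z‖`. [folklore] -/
theorem sqn_le_norm (z : ℂ) : sqn z ≤ ‖z‖ :=
  max_le (abs_re_le_norm z) (abs_im_le_norm z)

/-- `0 ≤ sqn z`. [folklore] -/
theorem sqn_nonneg (z : ℂ) : 0 ≤ sqn z := (abs_nonneg _).trans (le_max_left _ _)

/-- `‖z‖² ≤ 2 · sqn z²`. [folklore] -/
theorem norm_sq_le_two_mul_sqn_sq (z : ℂ) : ‖z‖ ^ 2 ≤ 2 * sqn z ^ 2 := by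
  have h1 : |z.re| ≤ sqn z := le_max_left _ _
  have h2 : |z.im| ≤ sqn z := le_max_right _ _
  rw [Complex.sq_norm, Complex.normSq_apply]
  nlinarith [sq_abs z.re, sq_abs z.im, abs_nonneg z.re, abs_nonneg z.im]

/-- `sqn (t z) = t · sqn z` for `t ≥ 0`. [folklore] -/
theorem sqn_real_smul {t : ℝ} (ht : 0 ≤ t) (z : ℂ) : sqn ((t : ℂ) * z) = t * sqn z := by
  unfold sqn
  rw [re_ofReal_mul, im_ofReal_mul, abs_mul, abs_mul, abs_of_nonneg ht, ← mul_max_of_nonneg _ _ ht]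

/-- `sqn z < r` iff `z` lies in the open square `(-r, r)²`. [folklore] -/
theorem sqn_lt_iff {z : ℂ} {r : ℝ} : sqn z < r ↔ z ∈ Ioo (-r) r ×ℂ Ioo (-r) r := by
  simp only [sqn, max_lt_iff, abs_lt, mem_reProdIm, mem_Ioo]

/-- `sqn z ≤ r` iff `z` lies in the closed square `[-r, r]²`. [folklore] -/
theorem sqn_le_iff {z : ℂ} {r : ℝ} : sqn z ≤ r ↔ z ∈ Icc (-r) r ×ℂ Icc (-r) r := by
  simp only [sqn, max_le_iff, abs_le, mem_reProdIm, mem_Icc]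

/-- The frontier of the open square `(-r, r)²` is `{sqn = r}` (`r > 0`). [folklore] -/
theorem frontier_square {r : ℝ} (hr : 0 < r) :
    frontier (Ioo (-r) r ×ℂ Ioo (-r) r) = {z | sqn z = r} := by
  have h1 : closure (Ioo (-r) r ×ℂ Ioo (-r) r) = {z | sqn z ≤ r} := by
    rw [closure_reProdIm, closure_Ioo (by linarith : (-r) ≠ r)]
    ext z; rw [mem_setOf_eq, sqn_le_iff]
  have h2 : interior (Ioo (-r) r ×ℂ Ioo (-r) r) = {z | sqn z < r} := by
    rw [interior_reProdIm, interior_Ioo]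
    ext z; rw [mem_setOf_eq, sqn_lt_iff]
  rw [frontier, h1, h2]
  ext z
  simp only [Set.mem_sdiff, mem_setOf_eq, not_lt]
  constructor
  · rintro ⟨h, h'⟩; exact le_antisymm h h'
  · intro h; exact ⟨h.le, h.ge⟩

/-! ### Shifting a Jordan loop -/

/-- **A shifted Jordan loop is a Jordan loop.** [folklore] -/
theorem _root_.Literature.Topology.PlaneTopology.IsJordanLoop.shift {γ : ℝ → ℂ}
    (h : IsJordanLoop γ) (s : ℝ) : IsJordanLoop fun t ↦ γ (t + s) := by
  refine ⟨h.continuous.comp (continuous_id.add continuous_const), fun t ↦ ?_, ?_⟩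
  · show γ (t + 1 + s) = γ (t + s)
    rw [show t + 1 + s = t + s + 1 by ring, h.periodic]
  · -- injectivity on `[0, 1)`: reduce both parameters into `[0, 1)` modulo `1`
    intro u hu v hv huv
    simp only at huv
    have key : ∀ w : ℝ, γ (w + s) = γ (Int.fract (w + s)) := fun w ↦ by
      have h1 := h.periodic.int_mul ⌊w + s⌋ (Int.fract (w + s))
      rwa [mul_one, Int.fract_add_floor] at h1
    rw [key u, key v] at huv
    have hfu : Int.fract (u + s) ∈ Ico (0 : ℝ) 1 := ⟨Int.fract_nonneg _, Int.fract_lt_one _⟩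
    have hfv : Int.fract (v + s) ∈ Ico (0 : ℝ) 1 := ⟨Int.fract_nonneg _, Int.fract_lt_one _⟩
    have heq := h.injOn hfu hfv huv
    -- `fract (u+s) = fract (v+s)` with `u - v ∈ (-1, 1)` forces `u = v`
    rw [Int.fract_eq_fract] at heq
    obtain ⟨z, hz⟩ := heq
    have hz' : (u - v : ℝ) = z := by linarith
    have hlt : |(z : ℝ)| < 1 := by
      rw [← hz', abs_lt]; constructor <;> linarith [hu.1, hu.2, hv.1, hv.2]
    have hz0 : z = 0 := by
      have : |z| < 1 := by exact_mod_cast hlt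
      exact Int.abs_lt_one_iff.1 this
    have : u - v = 0 := by rw [hz', hz0]; simp
    linarith

/-- A Jordan loop is injective on every closed interval of length `< 1`. [folklore] -/
theorem _root_.Literature.Topology.PlaneTopology.IsJordanLoop.injOn_Icc_of_lt {γ : ℝ → ℂ}
    (h : IsJordanLoop γ) {s t : ℝ} (hst : t - s < 1) : InjOn γ (Icc s t) := by
  intro u hu v hv huv
  have hu' : u - s ∈ Ico (0 : ℝ) 1 := ⟨by linarith [hu.1], by linarith [hu.2]⟩
  have hv' : v - s ∈ Ico (0 : ℝ) 1 := ⟨by linarith [hv.1], by linarith [hv.2]⟩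
  have h' : u - s = v - s :=
    (h.shift s).injOn hu' hv' (by show γ (u - s + s) = γ (v - s + s); simpa only [sub_add_cancel] using huv)
  linarith

/-- The range of a shifted loop. [folklore] -/
theorem range_shift (γ : ℝ → ℂ) (s : ℝ) : range (fun t ↦ γ (t + s)) = range γ := by
  ext z
  constructor
  · rintro ⟨t, rfl⟩; exact ⟨t + s, rfl⟩
  · rintro ⟨t, rfl⟩; exact ⟨t - s, by simp⟩

/-- The inside of a shifted loop. [folklore] -/
theorem inside_shift (γ : ℝ → ℂ) (s : ℝ) :
    IsJordanLoop.inside (fun t ↦ γ (t + s)) = IsJordanLoop.inside γ := by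
  unfold IsJordanLoop.inside
  rw [range_shift]

/-! ### The data -/

/-- **The data of the three-chamber configuration** (normalised: boundary point `0`, interior
point `x = r + ai`, `0 ≤ a ≤ r`): an open set `Ω ∌ 0` containing the open square of centre `x`
and half-side `r`, and a conformal map `F` of the unit disc onto `Ω`, continuous on the closed
disc, with inverse `ψ`. [cite: LawlerSchrammWerner2004, proof of Lemma 5.4] -/
structure Setup where
  /-- the domain -/
  Ω : Set ℂ
  /-- the conformal map `𝔻 → Ω` -/
  F : ℂ → ℂ
  /-- its inverse `Ω → 𝔻` -/
  ψ : ℂ → ℂ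
  /-- the sup-distance from `x` to `∂Ω` -/
  r : ℝ
  /-- the height of `x` above the boundary point `0`, `x = r + a i` -/
  a : ℝ
  isOpen : IsOpen Ω
  r_pos : 0 < r
  a_nonneg : 0 ≤ a
  a_le : a ≤ r
  zero_notMem : (0 : ℂ) ∉ Ω
  square_subset : {z : ℂ | |z.re - r| < r ∧ |z.im - a| < r} ⊆ Ω
  F_cont : ContinuousOn F (closedBall 0 1)
  F_diff : DifferentiableOn ℂ F (ball 0 1)
  F_maps : MapsTo F (ball 0 1) Ω
  ψ_maps : MapsTo ψ Ω (ball 0 1)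
  ψ_diff : DifferentiableOn ℂ ψ Ω
  F_ψ : ∀ z ∈ Ω, F (ψ z) = z
  ψ_F : ∀ w ∈ ball (0 : ℂ) 1, ψ (F w) = w

namespace Setup

variable (S : Setup)

/-- The interior point `x = r + a i`. [cite: LawlerSchrammWerner2004, proof of Lemma 5.4] -/
def x : ℂ := (S.r : ℂ) + (S.a : ℂ) * I

/-- The conformal centre `c = ψ x`. [cite: LawlerSchrammWerner2004, proof of Lemma 5.4] -/
def c : ℂ := S.ψ S.x

/-- The signed area form `r · im z - a · re z` (`= im (z x̄)`), positive to the left of the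
directed line `0 → x`. [folklore] -/
def side (z : ℂ) : ℝ := S.r * z.im - S.a * z.re

/-- The near ball `B₀ = B(x, 9r/10)`. [cite: LawlerSchrammWerner2004, proof of Lemma 5.4] -/
def B₀ : Set ℂ := ball S.x (9 * S.r / 10)

/-- The gate set `G = [0, x] ∪ ∂Q'` (`∂Q' = {sqn = r}`): connected sets avoiding `G` do not
change chamber. [cite: LawlerSchrammWerner2004, proof of Lemma 5.4] -/
def G : Set ℂ := segment ℝ 0 S.x ∪ {z | sqn z = S.r}

/-- The three launch regions: `V 0 = B₀ ∩ {re > r}` (outside `Q'`, chamber `K₁`),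
`V 1 = B₀ ∩ Q' ∩ {side < 0}` (clockwise side of `[0, x]`, chamber `K₂`),
`V 2 = B₀ ∩ Q' ∩ {side > 0}` (counter-clockwise side, chamber `K₃`).
[cite: LawlerSchrammWerner2004, proof of Lemma 5.4] -/
def V : Fin 3 → Set ℂ
  | 0 => S.B₀ ∩ {z | S.r < z.re}
  | 1 => S.B₀ ∩ {z | sqn z < S.r} ∩ {z | S.side z < 0}
  | 2 => S.B₀ ∩ {z | sqn z < S.r} ∩ {z | 0 < S.side z}

/-! ### Elementary facts -/

/-- Real part of `x`. [folklore] -/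
theorem x_re : S.x.re = S.r := by simp [x]

/-- Imaginary part of `x`. [folklore] -/
theorem x_im : S.x.im = S.a := by simp [x]

/-- `x` lies on `∂Q'`. [folklore] -/
theorem sqn_x : sqn S.x = S.r := by
  rw [sqn, x_re, x_im, abs_of_pos S.r_pos, abs_of_nonneg S.a_nonneg, max_eq_left S.a_le]

/-- `x` lies on the line `{side = 0}`. [folklore] -/
theorem side_x : S.side S.x = 0 := by rw [side, x_re, x_im]; ring

/-- `‖x‖ ≥ r`. [folklore] -/
theorem norm_x_ge : S.r ≤ ‖S.x‖ := by
  have := abs_re_le_norm S.x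
  rwa [x_re, abs_of_pos S.r_pos] at this

/-- `x ∈ Ω`. [folklore] -/
theorem x_mem : S.x ∈ S.Ω :=
  S.square_subset ⟨by rw [x_re, sub_self, abs_zero]; exact S.r_pos,
    by rw [x_im, sub_self, abs_zero]; exact S.r_pos⟩

/-- `B(x, r) ⊆ Ω`. [folklore] -/
theorem ball_subset : ball S.x S.r ⊆ S.Ω := fun z hz ↦ by
  rw [mem_ball, dist_eq_norm] at hz
  refine S.square_subset ⟨?_, ?_⟩
  · have := abs_re_le_norm (z - S.x)
    rw [sub_re, x_re] at this
    exact this.trans_lt hz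
  · have := abs_im_le_norm (z - S.x)
    rw [sub_im, x_im] at this
    exact this.trans_lt hz

/-- `B₀ ⊆ B(x, r) ⊆ Ω`. [folklore] -/
theorem B₀_subset_ball : S.B₀ ⊆ ball S.x S.r :=
  ball_subset_ball (by linarith [S.r_pos])

/-- `B₀ ⊆ Ω`. [folklore] -/
theorem B₀_subset : S.B₀ ⊆ S.Ω := S.B₀_subset_ball.trans S.ball_subset

/-- `B₀` is open. [folklore] -/
theorem isOpen_B₀ : IsOpen S.B₀ := isOpen_ball

/-- `x ∈ B₀`. [folklore] -/
theorem x_mem_B₀ : S.x ∈ S.B₀ := mem_ball_self (by have := S.r_pos; positivity)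

/-- The closed near ball `B̄(x, 9r/10)` lies in `Ω`. [folklore] -/
theorem closedBall_subset : closedBall S.x (9 * S.r / 10) ⊆ S.Ω :=
  (closedBall_subset_ball (by linarith [S.r_pos])).trans S.ball_subset

/-- The open segment `(0, x]`: the points `t x`, `0 < t ≤ 1`, lie in `Ω`. [folklore] -/
theorem smul_x_mem {t : ℝ} (ht0 : 0 < t) (ht1 : t ≤ 1) : (t : ℂ) * S.x ∈ S.Ω := by
  refine S.square_subset ⟨?_, ?_⟩
  · rw [re_ofReal_mul, x_re, show t * S.r - S.r = -((1 - t) * S.r) by ring, abs_neg,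
      abs_of_nonneg (mul_nonneg (by linarith) S.r_pos.le)]
    nlinarith [S.r_pos]
  · rw [im_ofReal_mul, x_im, show t * S.a - S.a = -((1 - t) * S.a) by ring, abs_neg,
      abs_of_nonneg (mul_nonneg (by linarith) S.a_nonneg)]
    nlinarith [S.r_pos, S.a_le, S.a_nonneg]

/-- Points of the segment `[0, x]` are the `t x`, `t ∈ [0, 1]`. [folklore] -/
theorem mem_segment_iff {z : ℂ} : z ∈ segment ℝ 0 S.x ↔ ∃ t ∈ Icc (0 : ℝ) 1, z = (t : ℂ) * S.x := by
  rw [segment_eq_image']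
  simp only [mem_image, sub_zero, zero_add, real_smul]
  constructor
  · rintro ⟨t, ht, rfl⟩; exact ⟨t, ht, rfl⟩
  · rintro ⟨t, ht, rfl⟩; exact ⟨t, ht, rfl⟩

/-- `side (t x) = 0`. [folklore] -/
theorem side_smul_x (t : ℝ) : S.side ((t : ℂ) * S.x) = 0 := by
  rw [side, re_ofReal_mul, im_ofReal_mul, x_re, x_im]; ring

/-- `sqn (t x) = t r` for `t ≥ 0`. [folklore] -/
theorem sqn_smul_x {t : ℝ} (ht : 0 ≤ t) : sqn ((t : ℂ) * S.x) = t * S.r := by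
  rw [sqn_real_smul ht, sqn_x]

/-- `side` is continuous. [folklore] -/
@[fun_prop] theorem continuous_side : Continuous S.side := by unfold side; fun_prop

/-- `ψ` is continuous on `Ω`. [folklore] -/
theorem ψ_cont : ContinuousOn S.ψ S.Ω := S.ψ_diff.continuousOn

/-- `ψ` is injective on `Ω`. [folklore] -/
theorem ψ_injOn : InjOn S.ψ S.Ω := fun z hz w hw h ↦ by
  rw [← S.F_ψ z hz, ← S.F_ψ w hw, h]

/-- The launch regions lie in `B₀`. [folklore] -/
theorem V_subset_B₀ (j : Fin 3) : S.V j ⊆ S.B₀ := by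
  fin_cases j
  · exact inter_subset_left
  · exact inter_subset_left.trans inter_subset_left
  · exact inter_subset_left.trans inter_subset_left

/-- The launch regions avoid the gate set. [folklore] -/
theorem disjoint_V_G (j : Fin 3) : Disjoint (S.V j) S.G := by
  rw [Set.disjoint_left]
  intro z hz hzG
  rcases hzG with hseg | hsq
  · obtain ⟨t, ht, rfl⟩ := S.mem_segment_iff.1 hseg
    fin_cases j
    · have h := hz.2
      simp only [mem_setOf_eq, re_ofReal_mul, x_re] at h
      nlinarith [ht.2, S.r_pos]
    · have h := hz.2
      simp only [mem_setOf_eq, side_smul_x, lt_irrefl] at h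
    · have h := hz.2
      simp only [mem_setOf_eq, side_smul_x, lt_irrefl] at h
  · rw [mem_setOf_eq] at hsq
    fin_cases j
    · have h : S.r < z.re := hz.2
      have : |z.re| ≤ sqn z := le_max_left _ _
      rw [hsq] at this
      linarith [le_abs_self z.re]
    · have h : sqn z < S.r := hz.1.2
      linarith
    · have h : sqn z < S.r := hz.1.2
      linarith

/-- The open square `{sqn < r}` is convex. [folklore] -/
theorem _root_.Literature.Analysis.Complex.convex_sqn_lt (r : ℝ) : Convex ℝ {z : ℂ | sqn z < r} := by
  have : {z : ℂ | sqn z < r} = Ioo (-r) r ×ℂ Ioo (-r) r := by ext z; exact sqn_lt_iff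
  rw [this, ← convexHull_eq_self, Complex.convexHull_reProdIm, (convex_Ioo _ _).convexHull_eq]

/-- The launch regions are convex. [folklore] -/
theorem convex_V (j : Fin 3) : Convex ℝ (S.V j) := by
  have hB : Convex ℝ S.B₀ := convex_ball _ _
  have hsq : Convex ℝ {z : ℂ | sqn z < S.r} := convex_sqn_lt S.r
  -- `side` is a linear functional
  set L : ℂ →ₗ[ℝ] ℝ := S.r • Complex.imLm - S.a • Complex.reLm with hL
  have hLside : ∀ z, L z = S.side z := fun z ↦ by simp [hL, side]
  fin_cases j
  · exact hB.inter (convex_halfSpace_re_gt S.r)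
  · refine (hB.inter hsq).inter ?_
    have : {z : ℂ | S.side z < 0} = {z | L z < 0} := by ext z; rw [mem_setOf_eq, mem_setOf_eq, hLside]
    rw [this]
    exact convex_halfSpace_lt L.isLinear 0
  · refine (hB.inter hsq).inter ?_
    have : {z : ℂ | 0 < S.side z} = {z | 0 < L z} := by ext z; rw [mem_setOf_eq, mem_setOf_eq, hLside]
    rw [this]
    exact convex_halfSpace_gt L.isLinear 0

/-- The launch regions are preconnected. [folklore] -/
theorem isPreconnected_V (j : Fin 3) : IsPreconnected (S.V j) := (S.convex_V j).isPreconnected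

/-! ### The square loop based at `x` -/

/-- The open square `Q' = (-r, r)²` as a Jordan domain. [folklore] -/
def sq : JordanDomain := rect (a := -S.r) (b := S.r) (c := -S.r) (d := S.r)
  (by linarith [S.r_pos]) (by linarith [S.r_pos])

/-- The parameter of `x` on the boundary loop of `rect`: `x` is on the right side, run in the
second quarter. [folklore] -/
def tx : ℝ := 1 / 4 + (S.a + S.r) / (8 * S.r)

/-- `tx ∈ [3/8, 1/2]`. [folklore] -/
theorem tx_mem : S.tx ∈ Icc (3 / 8 : ℝ) (1 / 2) := by
  have hr := S.r_pos
  constructor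
  · rw [tx]
    have : (1 : ℝ) / 8 ≤ (S.a + S.r) / (8 * S.r) := by
      rw [div_le_div_iff₀ (by norm_num) (by positivity)]; nlinarith [S.a_nonneg]
    linarith
  · rw [tx]
    have : (S.a + S.r) / (8 * S.r) ≤ 1 / 4 := by
      rw [div_le_div_iff₀ (by positivity) (by norm_num)]; nlinarith [S.a_le]
    linarith

/-- **The boundary loop `σ` of `Q'` based at `x`, counter-clockwise.**
[cite: LawlerSchrammWerner2004, proof of Lemma 5.4] -/
def sqLoop (t : ℝ) : ℂ := S.sq.boundary (t + S.tx)

/-- Unfolding `σ`. [folklore] -/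
theorem sqLoop_def : S.sqLoop = fun t ↦ S.sq.boundary (t + S.tx) := rfl

/-- The four sides of `Q'` close up. [folklore] -/
theorem sq_junction : QuadJunction (seg ((-S.r : ℝ) + (-S.r : ℝ) * I) (S.r + (-S.r : ℝ) * I))
    (seg (S.r + (-S.r : ℝ) * I) (S.r + S.r * I)) (seg (S.r + S.r * I) ((-S.r : ℝ) + S.r * I))
    (seg ((-S.r : ℝ) + S.r * I) ((-S.r : ℝ) + (-S.r : ℝ) * I)) := ⟨by simp, by simp, by simp, by simp⟩

/-- `σ` in terms of `quadLoop`. [folklore] -/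
theorem sqLoop_apply (t : ℝ) : S.sqLoop t = quadLoop (seg ((-S.r : ℝ) + (-S.r : ℝ) * I) (S.r + (-S.r : ℝ) * I))
    (seg (S.r + (-S.r : ℝ) * I) (S.r + S.r * I)) (seg (S.r + S.r * I) ((-S.r : ℝ) + S.r * I))
    (seg ((-S.r : ℝ) + S.r * I) ((-S.r : ℝ) + (-S.r : ℝ) * I)) (t + S.tx) := rfl

/-- `σ` is a Jordan loop. [folklore] -/
theorem isJordanLoop_sqLoop : IsJordanLoop S.sqLoop := S.sq.isJordanLoop_boundary.shift S.tx

/-- `σ` is continuous. [folklore] -/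
theorem continuous_sqLoop : Continuous S.sqLoop := S.isJordanLoop_sqLoop.continuous

/-- `σ` is `1`-periodic. [folklore] -/
theorem periodic_sqLoop : Periodic S.sqLoop 1 := S.isJordanLoop_sqLoop.periodic

/-- The range of `σ` is `∂Q' = {sqn = r}`. [folklore] -/
theorem range_sqLoop : range S.sqLoop = {z | sqn z = S.r} := by
  rw [sqLoop_def, range_shift S.sq.boundary S.tx, S.sq.range_boundary, sq, rect_carrier,
    frontier_square S.r_pos]

/-- Points of `σ` have sup-norm `r`. [folklore] -/
theorem sqn_sqLoop (t : ℝ) : sqn (S.sqLoop t) = S.r := by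
  have : S.sqLoop t ∈ range S.sqLoop := ⟨t, rfl⟩
  rw [range_sqLoop] at this
  exact this

/-- The inside of `σ` is the open square `Q'`. [folklore] -/
theorem inside_sqLoop : IsJordanLoop.inside S.sqLoop = {z | sqn z < S.r} := by
  rw [sqLoop_def, inside_shift S.sq.boundary S.tx, S.sq.inside_boundary_eq_carrier, sq, rect_carrier]
  ext z; exact sqn_lt_iff.symm

/-- `0` is inside `σ`. [folklore] -/
theorem zero_mem_inside_sqLoop : (0 : ℂ) ∈ IsJordanLoop.inside S.sqLoop := by
  rw [inside_sqLoop, mem_setOf_eq, sqn]; simp [S.r_pos]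

/-- **`σ` on the right side**: for `t ∈ [-(a+r)/(8r), (r-a)/(8r)]`, `σ t = r + (a + 8rt) i`.
[folklore] -/
theorem sqLoop_right {t : ℝ} (ht1 : -((S.a + S.r) / (8 * S.r)) ≤ t) (ht2 : t ≤ (S.r - S.a) / (8 * S.r)) :
    S.sqLoop t = (S.r : ℂ) + ((S.a + 8 * S.r * t : ℝ) : ℂ) * I := by
  have hr := S.r_pos
  have hmem : t + S.tx ∈ Icc (1 / 4 : ℝ) (1 / 2) := by
    constructor
    · rw [tx]
      have : (S.a + S.r) / (8 * S.r) + t ≥ 0 := by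
        have h := ht1; linarith
      linarith
    · rw [tx]
      have h1 : t + (S.a + S.r) / (8 * S.r) ≤ (S.r - S.a) / (8 * S.r) + (S.a + S.r) / (8 * S.r) := by
        linarith
      have h2 : (S.r - S.a) / (8 * S.r) + (S.a + S.r) / (8 * S.r) = 1 / 4 := by
        field_simp; ring
      linarith
  have hr0 : (S.r : ℂ) ≠ 0 := by exact_mod_cast hr.ne'
  rw [sqLoop_apply, quadLoop_apply_of_mem_second S.sq_junction hmem, seg, tx]
  push_cast
  field_simp
  ring

/-- **`σ` on the top side**: for `t ∈ [(r-a)/(8r), (r-a)/(8r) + 1/4]`,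
`σ t = (r - 8r (t - (r-a)/(8r))) + r i`. [folklore] -/
theorem sqLoop_top {t : ℝ} (ht1 : (S.r - S.a) / (8 * S.r) ≤ t) (ht2 : t ≤ (S.r - S.a) / (8 * S.r) + 1 / 4) :
    S.sqLoop t = ((S.r - 8 * S.r * (t - (S.r - S.a) / (8 * S.r)) : ℝ) : ℂ) + (S.r : ℂ) * I := by
  have hr := S.r_pos
  have h2 : (S.r - S.a) / (8 * S.r) + S.tx = 1 / 2 := by rw [tx]; field_simp; ring
  have hmem : t + S.tx ∈ Icc (1 / 2 : ℝ) (3 / 4) := by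
    constructor <;> linarith
  have hr0 : (S.r : ℂ) ≠ 0 := by exact_mod_cast hr.ne'
  rw [sqLoop_apply, quadLoop_apply_of_mem_third S.sq_junction hmem, seg, tx]
  push_cast
  field_simp
  ring

/-- The parameter length of `[bottom-right corner, x]` is nonnegative. [folklore] -/
theorem tP_nonneg : 0 ≤ (S.a + S.r) / (8 * S.r) :=
  div_nonneg (by linarith [S.a_nonneg, S.r_pos]) (by linarith [S.r_pos])

/-- The parameter length of `[x, top-right corner]` is nonnegative. [folklore] -/
theorem tQ_nonneg : 0 ≤ (S.r - S.a) / (8 * S.r) :=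
  div_nonneg (by linarith [S.a_le]) (by linarith [S.r_pos])

/-- `σ 0 = x`. [folklore] -/
theorem sqLoop_zero : S.sqLoop 0 = S.x := by
  rw [S.sqLoop_right (by linarith [S.tP_nonneg]) S.tQ_nonneg, x]
  simp

/-- **Just after `x` the loop is on the counter-clockwise side**: `side (σ t) > 0` for
`0 < t ≤ 1/4`. [folklore] -/
theorem side_sqLoop_pos {t : ℝ} (ht0 : 0 < t) (ht1 : t ≤ 1 / 4) : 0 < S.side (S.sqLoop t) := by
  have hr := S.r_pos
  set t₁ : ℝ := (S.r - S.a) / (8 * S.r) with ht₁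
  have ht₁0 : 0 ≤ t₁ := div_nonneg (by linarith [S.a_le]) (by positivity)
  rcases le_or_gt t t₁ with h | h
  · -- still on the right side
    rw [S.sqLoop_right (by linarith [S.tP_nonneg]) h]
    have hside : S.side ((S.r : ℂ) + ((S.a + 8 * S.r * t : ℝ) : ℂ) * I) = 8 * S.r ^ 2 * t := by
      simp [side]; ring
    rw [hside]
    positivity
  · -- on the top side
    have ht1' : t ≤ t₁ + 1 / 4 := by linarith
    rw [S.sqLoop_top h.le ht1']
    -- `side = r² - a (r - 8r (t - t₁)) = r(r - a) + 8 a r (t - t₁)`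
    have hside : S.side (((S.r - 8 * S.r * (t - t₁) : ℝ) : ℂ) + (S.r : ℂ) * I) =
        S.r * (S.r - S.a) + 8 * S.a * S.r * (t - t₁) := by
      simp [side]; ring
    rw [hside]
    have h1 : 0 ≤ S.r * (S.r - S.a) := mul_nonneg hr.le (by linarith [S.a_le])
    have ha := S.a_nonneg
    have h2 : 0 ≤ 8 * S.a * S.r * (t - t₁) := by
      have : 0 ≤ t - t₁ := by linarith
      positivity
    -- strict: if `a = r` the second term is positive, else the first
    rcases lt_or_eq_of_le S.a_le with hlt | heq
    · nlinarith [mul_pos hr (sub_pos.2 hlt)]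
    · have h3 : 0 < 8 * S.a * S.r * (t - t₁) := by
        have : 0 < t - t₁ := by linarith
        rw [heq]; positivity
      linarith

/-- **Just before `x` the loop is on the clockwise side**: `side (σ t) < 0` for
`-1/8 ≤ t < 0`. [folklore] -/
theorem side_sqLoop_neg {t : ℝ} (ht0 : -(1 / 8 : ℝ) ≤ t) (ht1 : t < 0) : S.side (S.sqLoop t) < 0 := by
  have hr := S.r_pos
  have h1 : -((S.a + S.r) / (8 * S.r)) ≤ t := by
    have : (1 : ℝ) / 8 ≤ (S.a + S.r) / (8 * S.r) := by
      rw [div_le_div_iff₀ (by norm_num) (by positivity)]; nlinarith [S.a_nonneg]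
    linarith
  rw [S.sqLoop_right h1 (by linarith [S.tQ_nonneg])]
  have hside : S.side ((S.r : ℂ) + ((S.a + 8 * S.r * t : ℝ) : ℂ) * I) = 8 * S.r ^ 2 * t := by
    simp [side]; ring
  rw [hside]
  have : 0 < 8 * S.r ^ 2 * (-t) := by have := neg_pos.2 ht1; positivity
  linarith

/-- The loop moves at speed `≤ 8r` near `x`: `‖σ t - x‖ ≤ 8 r |t|` for `|t| ≤ 1/8` on the right
side piece, enough for `σ [-(a+r)/(8r) ⊓ …]`; we only need: **`σ t ∈ B₀` for
`|t| ≤ 1/10` when `σ t` is on the right side**, and in general the qualitative statement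
`sqLoop_mem_nhds`. [folklore] -/
theorem sqLoop_eventually_mem_B₀ : ∀ᶠ t in 𝓝 (0 : ℝ), S.sqLoop t ∈ S.B₀ := by
  have h : ContinuousAt S.sqLoop 0 := S.continuous_sqLoop.continuousAt
  have : S.B₀ ∈ 𝓝 (S.sqLoop 0) := by rw [sqLoop_zero]; exact S.isOpen_B₀.mem_nhds S.x_mem_B₀
  exact h.preimage_mem_nhds this

/-! ### `∂Q'` is not contained in `Ω` -/

/-- **The boundary of `Q'` leaves `Ω`**: otherwise the loop `σ ⊆ Ω` would wind around
`0 ∉ Ω`, impossible in the conformal disc `Ω`. [cite: LawlerSchrammWerner2004, proof of Lemma 5.4] -/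
theorem exists_sqLoop_notMem : ∃ t ∈ Icc (0 : ℝ) 1, S.sqLoop t ∉ S.Ω := by
  by_contra h
  push Not at h
  have hall : ∀ t, S.sqLoop t ∈ S.Ω := fun t ↦ by
    have h1 := S.periodic_sqLoop.int_mul ⌊t⌋ (Int.fract t)
    rw [mul_one, Int.fract_add_floor] at h1
    rw [h1]
    exact h _ ⟨Int.fract_nonneg t, (Int.fract_lt_one t).le⟩
  have hw : wind (fun t ↦ S.sqLoop t - 0) = 0 :=
    wind_sub_eq_zero_of_leftInvOn (S.F_cont.mono ball_subset_closedBall) S.F_maps S.ψ_cont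
      S.ψ_maps S.F_ψ S.continuous_sqLoop.continuousOn S.isJordanLoop_sqLoop.eq_zero_one
      (fun t _ ↦ hall t) S.zero_notMem
  have hne := (S.isJordanLoop_sqLoop.mem_inside_iff_wind_ne_zero (z := 0) (by
    rw [range_sqLoop, mem_setOf_eq, sqn]; simp [S.r_pos.ne])).1 S.zero_mem_inside_sqLoop
  exact hne hw

/-! ### First exits: the gates `A₂ = σ (0, τ₊)` and `A₃ = σ (τ₋, 0)` -/

/-- The forward exit parameter `τ₊ = inf {t ∈ [0, 1] : σ t ∉ Ω}`.
[cite: LawlerSchrammWerner2004, proof of Lemma 5.4] -/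
def tauP : ℝ := sInf {t ∈ Icc (0 : ℝ) 1 | S.sqLoop t ∉ S.Ω}

/-- The backward exit parameter `τ₋ = sup {t ∈ [-1, 0] : σ t ∉ Ω}`.
[cite: LawlerSchrammWerner2004, proof of Lemma 5.4] -/
def tauM : ℝ := sSup {t ∈ Icc (-1 : ℝ) 0 | S.sqLoop t ∉ S.Ω}

/-- The forward exit set is closed. [folklore] -/
theorem isClosed_exitSetP : IsClosed {t ∈ Icc (0 : ℝ) 1 | S.sqLoop t ∉ S.Ω} := by
  have : {t ∈ Icc (0 : ℝ) 1 | S.sqLoop t ∉ S.Ω} = Icc 0 1 ∩ S.sqLoop ⁻¹' S.Ωᶜ := rfl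
  rw [this]
  exact isClosed_Icc.inter (S.isOpen.isClosed_compl.preimage S.continuous_sqLoop)

/-- The backward exit set is closed. [folklore] -/
theorem isClosed_exitSetM : IsClosed {t ∈ Icc (-1 : ℝ) 0 | S.sqLoop t ∉ S.Ω} := by
  have : {t ∈ Icc (-1 : ℝ) 0 | S.sqLoop t ∉ S.Ω} = Icc (-1) 0 ∩ S.sqLoop ⁻¹' S.Ωᶜ := rfl
  rw [this]
  exact isClosed_Icc.inter (S.isOpen.isClosed_compl.preimage S.continuous_sqLoop)

/-- The forward exit set is nonempty. [folklore] -/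
theorem exitSetP_nonempty : {t ∈ Icc (0 : ℝ) 1 | S.sqLoop t ∉ S.Ω}.Nonempty := by
  obtain ⟨t, ht, h⟩ := S.exists_sqLoop_notMem
  exact ⟨t, ht, h⟩

/-- The backward exit set is nonempty. [folklore] -/
theorem exitSetM_nonempty : {t ∈ Icc (-1 : ℝ) 0 | S.sqLoop t ∉ S.Ω}.Nonempty := by
  obtain ⟨t, ht, h⟩ := S.exists_sqLoop_notMem
  refine ⟨t - 1, ⟨by linarith [ht.1], by linarith [ht.2]⟩, ?_⟩
  show S.sqLoop (t - 1) ∉ S.Ω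
  rwa [show S.sqLoop (t - 1) = S.sqLoop t by
    have := S.periodic_sqLoop (t - 1); rw [sub_add_cancel] at this; exact this.symm]

/-- **`τ₊ ∈ (0, 1]`, `σ τ₊ ∉ Ω`, and `σ [0, τ₊) ⊆ Ω`.** [folklore] -/
theorem tauP_spec : S.tauP ∈ Ioc (0 : ℝ) 1 ∧ S.sqLoop S.tauP ∉ S.Ω ∧
    ∀ t ∈ Ico (0 : ℝ) S.tauP, S.sqLoop t ∈ S.Ω := by
  have hbdd : BddBelow {t ∈ Icc (0 : ℝ) 1 | S.sqLoop t ∉ S.Ω} := ⟨0, fun t ht ↦ ht.1.1⟩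
  have hmem : S.tauP ∈ {t ∈ Icc (0 : ℝ) 1 | S.sqLoop t ∉ S.Ω} :=
    S.isClosed_exitSetP.csInf_mem S.exitSetP_nonempty hbdd
  have hbelow : ∀ t ∈ Ico (0 : ℝ) S.tauP, S.sqLoop t ∈ S.Ω := by
    intro t ht
    by_contra hn
    have : S.tauP ≤ t := csInf_le hbdd ⟨⟨ht.1, ht.2.le.trans hmem.1.2⟩, hn⟩
    exact (not_le.2 ht.2) this
  have hpos : 0 < S.tauP := by
    rcases eq_or_lt_of_le hmem.1.1 with h | h
    · exfalso
      have := hmem.2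
      rw [← h, sqLoop_zero] at this
      exact this S.x_mem
    · exact h
  exact ⟨⟨hpos, hmem.1.2⟩, hmem.2, hbelow⟩

/-- **`τ₋ ∈ [-1, 0)`, `σ τ₋ ∉ Ω`, and `σ (τ₋, 0] ⊆ Ω`.** [folklore] -/
theorem tauM_spec : S.tauM ∈ Ico (-1 : ℝ) 0 ∧ S.sqLoop S.tauM ∉ S.Ω ∧
    ∀ t ∈ Ioc S.tauM 0, S.sqLoop t ∈ S.Ω := by
  have hbdd : BddAbove {t ∈ Icc (-1 : ℝ) 0 | S.sqLoop t ∉ S.Ω} := ⟨0, fun t ht ↦ ht.1.2⟩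
  have hmem : S.tauM ∈ {t ∈ Icc (-1 : ℝ) 0 | S.sqLoop t ∉ S.Ω} :=
    S.isClosed_exitSetM.csSup_mem S.exitSetM_nonempty hbdd
  have habove : ∀ t ∈ Ioc S.tauM 0, S.sqLoop t ∈ S.Ω := by
    intro t ht
    by_contra hn
    have : t ≤ S.tauM := le_csSup hbdd ⟨⟨hmem.1.1.trans ht.1.le, ht.2⟩, hn⟩
    exact (not_le.2 ht.1) this
  have hneg : S.tauM < 0 := by
    rcases eq_or_lt_of_le hmem.1.2 with h | h
    · exfalso
      have := hmem.2
      rw [h, sqLoop_zero] at this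
      exact this S.x_mem
    · exact h
  exact ⟨⟨hmem.1.1, hneg⟩, hmem.2, habove⟩

/-- **`τ₊ - τ₋ ≤ 1`**: otherwise `σ (τ₋, τ₊) ⊆ Ω` would cover a full period. [folklore] -/
theorem tauP_sub_tauM_le : S.tauP - S.tauM ≤ 1 := by
  by_contra h
  push Not at h
  obtain ⟨t, ht, hnot⟩ := S.exists_sqLoop_notMem
  obtain ⟨hP, -, hbelow⟩ := S.tauP_spec
  obtain ⟨hM, -, habove⟩ := S.tauM_spec
  -- either `t < τ₊` or `t - 1 > τ₋`
  rcases lt_or_ge t S.tauP with h1 | h1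
  · exact hnot (hbelow t ⟨ht.1, h1⟩)
  · have h2 : S.tauM < t - 1 := by linarith
    have := habove (t - 1) ⟨h2, by linarith [ht.2]⟩
    rw [show S.sqLoop (t - 1) = S.sqLoop t by
      have := S.periodic_sqLoop (t - 1); rw [sub_add_cancel] at this; exact this.symm] at this
    exact hnot this

/-- `σ` is injective on `[τ₋', τ₊']` whenever `τ₋ < τ₋' ≤ τ₊' < τ₊` (length `< 1`). [folklore] -/
theorem injOn_sqLoop {s t : ℝ} (hs : S.tauM < s) (ht : t < S.tauP) : InjOn S.sqLoop (Icc s t) :=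
  S.isJordanLoop_sqLoop.injOn_Icc_of_lt (by linarith [S.tauP_sub_tauM_le])

/-- Points of `σ (τ₋, τ₊)` other than `x`: `σ t ≠ x` for `t ∈ (τ₋, τ₊) ∖ {0}`. [folklore] -/
theorem sqLoop_ne_x {t : ℝ} (h1 : S.tauM < t) (h2 : t < S.tauP) (h0 : t ≠ 0) : S.sqLoop t ≠ S.x := by
  intro h
  rw [← sqLoop_zero] at h
  obtain ⟨hP, -⟩ := S.tauP_spec
  obtain ⟨hM, -⟩ := S.tauM_spec
  rcases lt_or_gt_of_ne h0 with hlt | hgt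
  · exact h0 (S.injOn_sqLoop h1 hP.1 ⟨le_rfl, hlt.le⟩ ⟨hlt.le, le_rfl⟩ h)
  · exact h0 (S.injOn_sqLoop hM.2 h2 ⟨hgt.le, le_rfl⟩ ⟨le_rfl, hgt.le⟩ h)

/-- The gates `A₂ = σ (0, τ₊)` and `A₃ = σ (τ₋, 0)` lie in `Ω ∩ ∂Q' ⊆ G`. [folklore] -/
theorem sqLoop_mem_G (t : ℝ) : S.sqLoop t ∈ S.G := Or.inr (S.sqn_sqLoop t)

end Setup

/-! ### Two-sidedness with an exceptional set of empty interior -/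

/-- **Local two-sidedness of a Jordan loop, with an exceptional set.** As
`IsJordanLoop.subset_inside_or_of_nhds`, but the covering `V ∖ E ⊆ P ∪ P'` is only required
off a set `E` with empty interior (the complementary components are open, so they meet `V`
off `E`). [folklore] -/
theorem _root_.Literature.Topology.PlaneTopology.IsJordanLoop.subset_inside_or_of_nhds'
    {γ : ℝ → ℂ} (h : IsJordanLoop γ) {x : ℂ} (hx : x ∈ range γ) {V E P P' : Set ℂ}
    (hV : V ∈ 𝓝 x) (hE : interior E = ∅) (hVPP : V \ E ⊆ P ∪ P') (hP : IsPreconnected P)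
    (hP' : IsPreconnected P') (hPγ : P ⊆ (range γ)ᶜ) (hP'γ : P' ⊆ (range γ)ᶜ) :
    (P ⊆ IsJordanLoop.inside γ ∧ P' ⊆ IsJordanLoop.outside γ) ∨
      (P ⊆ IsJordanLoop.outside γ ∧ P' ⊆ IsJordanLoop.inside γ) := by
  have hmeet : ∀ W : Set ℂ, IsOpen W → frontier W = range γ → (W ∩ (P ∪ P')).Nonempty := by
    intro W hWo hW
    have hxW : x ∈ closure W := frontier_subset_closure (hW ▸ hx)
    have hV' : interior V ∈ 𝓝 x := interior_mem_nhds.2 hV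
    obtain ⟨y, hyV, hyW⟩ := mem_closure_iff_nhds.1 hxW (interior V) hV'
    -- the open set `W ∩ interior V` is not contained in `E`
    have hO : IsOpen (W ∩ interior V) := hWo.inter isOpen_interior
    have hne : ¬ (W ∩ interior V ⊆ E) := fun hsub ↦ by
      have : W ∩ interior V ⊆ interior E := interior_maximal hsub hO
      rw [hE] at this
      exact this ⟨hyW, hyV⟩
    obtain ⟨y', ⟨hy'W, hy'V⟩, hy'E⟩ := not_subset.1 hne
    exact ⟨y', hy'W, hVPP ⟨interior_subset hy'V, hy'E⟩⟩
  rcases h.subset_inside_or_subset_outside hP hPγ with hPi | hPo <;>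
    rcases h.subset_inside_or_subset_outside hP' hP'γ with hP'i | hP'o
  · exfalso
    obtain ⟨y, hyo, hyPP⟩ := hmeet _ h.isOpen_outside h.frontier_outside
    have hyi : y ∈ IsJordanLoop.inside γ := hyPP.elim (fun hy ↦ hPi hy) (fun hy ↦ hP'i hy)
    exact Set.disjoint_left.1 IsJordanLoop.disjoint_inside_outside hyi hyo
  · exact Or.inl ⟨hPi, hP'o⟩
  · exact Or.inr ⟨hPo, hP'i⟩
  · exfalso
    obtain ⟨y, hyi, hyPP⟩ := hmeet _ h.isOpen_inside h.frontier_inside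
    have hyo : y ∈ IsJordanLoop.outside γ := hyPP.elim (fun hy ↦ hPo hy) (fun hy ↦ hP'o hy)
    exact Set.disjoint_left.1 IsJordanLoop.disjoint_inside_outside hyi hyo

/-- Under the hypotheses of `subset_inside_or_of_nhds'`, if `P'` meets the outside then
`P ⊆ inside γ`. [folklore] -/
theorem _root_.Literature.Topology.PlaneTopology.IsJordanLoop.subset_inside_of_nhds'
    {γ : ℝ → ℂ} (h : IsJordanLoop γ) {x : ℂ} (hx : x ∈ range γ) {V E P P' : Set ℂ}
    (hV : V ∈ 𝓝 x) (hE : interior E = ∅) (hVPP : V \ E ⊆ P ∪ P') (hP : IsPreconnected P)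
    (hP' : IsPreconnected P') (hPγ : P ⊆ (range γ)ᶜ) (hP'γ : P' ⊆ (range γ)ᶜ)
    (hP'o : (P' ∩ IsJordanLoop.outside γ).Nonempty) : P ⊆ IsJordanLoop.inside γ := by
  rcases h.subset_inside_or_of_nhds' hx hV hE hVPP hP hP' hPγ hP'γ with ⟨hPi, -⟩ | ⟨-, hP'i⟩
  · exact hPi
  · exfalso
    obtain ⟨y, hyP', hyo⟩ := hP'o
    exact Set.disjoint_left.1 IsJordanLoop.disjoint_inside_outside (hP'i hyP') hyo

/-! ### Empty interiors -/

namespace Setup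

variable (S : Setup)

/-- The line `{side = 0}` has empty interior. [folklore] -/
theorem interior_side_eq_zero : interior {z : ℂ | S.side z = 0} = ∅ := by
  rw [eq_empty_iff_forall_notMem]
  intro z hz
  rw [mem_interior_iff_mem_nhds, Metric.mem_nhds_iff] at hz
  obtain ⟨δ, hδ, hball⟩ := hz
  have hz0 : S.side z = 0 := hball (mem_ball_self hδ)
  have hmem : z + ((δ / 2 : ℝ) : ℂ) * I ∈ ball z δ := by
    rw [mem_ball, dist_eq_norm, add_sub_cancel_left, norm_mul, Complex.norm_real, norm_I,
      mul_one, Real.norm_eq_abs, abs_of_pos (by positivity)]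
    linarith
  have h : S.side (z + ((δ / 2 : ℝ) : ℂ) * I) = 0 := hball hmem
  simp only [side, add_re, mul_re, ofReal_re, I_re, mul_zero, ofReal_im, I_im, mul_one, sub_self,
    add_zero, add_im, mul_im] at h
  rw [side] at hz0
  have : S.r * (δ / 2) = 0 := by linear_combination h - hz0
  have := mul_eq_zero.1 this
  rcases this with h1 | h1
  · exact S.r_pos.ne' h1
  · linarith

/-- The square boundary `{sqn = r}` has empty interior. [folklore] -/
theorem interior_sqn_eq : interior {z : ℂ | sqn z = S.r} = ∅ := by
  rw [eq_empty_iff_forall_notMem]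
  intro z hz
  rw [mem_interior_iff_mem_nhds, Metric.mem_nhds_iff] at hz
  obtain ⟨δ, hδ, hball⟩ := hz
  have hz0 : sqn z = S.r := hball (mem_ball_self hδ)
  have hzne : z ≠ 0 := fun h ↦ by
    rw [h, sqn] at hz0; simp at hz0; exact S.r_pos.ne hz0
  -- dilate: `(1 + t) z` with `t` small has `sqn = (1 + t) r ≠ r`
  set t : ℝ := δ / (2 * ‖z‖) with ht
  have htpos : 0 < t := by positivity
  have hmem : ((1 + t : ℝ) : ℂ) * z ∈ ball z δ := by
    rw [mem_ball, dist_eq_norm, show ((1 + t : ℝ) : ℂ) * z - z = (t : ℂ) * z by push_cast; ring,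
      norm_mul, Complex.norm_real, Real.norm_eq_abs, abs_of_pos htpos, ht]
    have hn : 0 < ‖z‖ := norm_pos_iff.2 hzne
    rw [div_mul_eq_mul_div, div_lt_iff₀ (by positivity)]
    nlinarith
  have h := hball hmem
  rw [mem_setOf_eq, sqn_real_smul (by linarith) z, hz0] at h
  have : t * S.r = 0 := by linarith
  rcases mul_eq_zero.1 this with h1 | h1
  · exact htpos.ne' h1
  · exact S.r_pos.ne' h1

/-- The segment `[0, x]` lies on the line `{side = 0}`. [folklore] -/
theorem segment_subset_side : segment ℝ 0 S.x ⊆ {z | S.side z = 0} := fun z hz ↦ by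
  obtain ⟨t, -, rfl⟩ := S.mem_segment_iff.1 hz
  exact S.side_smul_x t

/-- The segment `[0, x]` is closed (segments are compact; stated for this segment only to avoid
restating the general fact, which lives in unrelated modules). [folklore] -/
theorem isClosed_segment_x : IsClosed (segment ℝ 0 S.x) := by
  rw [segment_eq_image]
  exact (isCompact_Icc.image (by fun_prop)).isClosed

/-- **The gate set `G` is closed with empty interior.** [folklore] -/
theorem isClosed_G : IsClosed S.G :=
  S.isClosed_segment_x.union (isClosed_eq continuous_sqn continuous_const)

/-- `G` has empty interior. [folklore] -/
theorem interior_G : interior S.G = ∅ := by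
  rw [G, interior_union_isClosed_of_interior_empty S.isClosed_segment_x]
  · exact subset_eq_empty (interior_mono S.segment_subset_side) S.interior_side_eq_zero
  · exact S.interior_sqn_eq

/-- **Level sets of `ψ` have empty interior**: `{z ∈ Ω | ‖ψ z - c‖ = ε}` contains no open set
(`ψ` maps open subsets of `Ω` to open sets, `ψ(O) = F⁻¹(O) ∩ 𝔻`, and spheres have empty
interior). [folklore] -/
theorem interior_levelSet {c' : ℂ} {ε : ℝ} (hε : ε ≠ 0) :
    interior {z ∈ S.Ω | ‖S.ψ z - c'‖ = ε} = ∅ := by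
  rw [eq_empty_iff_forall_notMem]
  intro z hz
  rw [mem_interior] at hz
  obtain ⟨O, hOsub, hOo, hzO⟩ := hz
  -- `ψ '' O` is open and contained in the sphere
  have hOΩ : O ⊆ S.Ω := fun y hy ↦ (hOsub hy).1
  have himg : S.ψ '' O = ball 0 1 ∩ S.F ⁻¹' O := by
    ext w
    constructor
    · rintro ⟨y, hy, rfl⟩
      exact ⟨S.ψ_maps (hOΩ hy), by rw [mem_preimage, S.F_ψ y (hOΩ hy)]; exact hy⟩
    · rintro ⟨hw, hwO⟩
      exact ⟨S.F w, hwO, S.ψ_F w hw⟩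
  have hopen : IsOpen (S.ψ '' O) := by
    rw [himg]
    exact (S.F_cont.mono ball_subset_closedBall).isOpen_inter_preimage isOpen_ball hOo
  have hsub : S.ψ '' O ⊆ sphere c' ε := by
    rintro _ ⟨y, hy, rfl⟩
    exact mem_sphere_iff_norm.2 (hOsub hy).2
  have hint : S.ψ '' O ⊆ interior (sphere c' ε) := interior_maximal hsub hopen
  rw [interior_sphere c' hε] at hint
  exact hint ⟨z, hzO, rfl⟩

/-- **`ψ`-images of compact subsets of `G` inside `Ω` have empty interior.** [folklore] -/
theorem interior_image_ψ {K : Set ℂ} (hKG : K ⊆ S.G) (hKΩ : K ⊆ S.Ω) :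
    interior (S.ψ '' K) = ∅ := by
  rw [eq_empty_iff_forall_notMem]
  intro w hw
  rw [mem_interior] at hw
  obtain ⟨O', hO'sub, hO'o, hwO'⟩ := hw
  -- pull back: `Ω ∩ ψ⁻¹ O'` is open and contained in `K ⊆ G`
  have hopen : IsOpen (S.Ω ∩ S.ψ ⁻¹' O') := S.ψ_cont.isOpen_inter_preimage S.isOpen hO'o
  have hsub : S.Ω ∩ S.ψ ⁻¹' O' ⊆ K := by
    rintro y ⟨hyΩ, hyO'⟩
    obtain ⟨k, hk, hk'⟩ := hO'sub hyO'
    rwa [← S.ψ_injOn (hKΩ hk) hyΩ hk']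
  have hint : S.Ω ∩ S.ψ ⁻¹' O' ⊆ interior S.G := interior_maximal (hsub.trans hKG) hopen
  rw [S.interior_G] at hint
  -- but it contains `F w`
  obtain ⟨k, hk, rfl⟩ := hO'sub hwO'
  exact hint ⟨hKΩ hk, hwO'⟩

/-! ### The complementary launch regions near `x` -/

/-- `ball x ρ ∩ {sqn > r} = (ball x ρ ∩ {re > r}) ∪ (ball x ρ ∩ {im > r})` for `ρ ≤ r`.
[folklore] -/
theorem ball_inter_sqn_gt {ρ : ℝ} (hρ : ρ ≤ S.r) :
    ball S.x ρ ∩ {z | S.r < sqn z} = (ball S.x ρ ∩ {z | S.r < z.re}) ∪ (ball S.x ρ ∩ {z | S.r < z.im}) := by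
  ext z
  simp only [mem_inter_iff, mem_union, mem_setOf_eq, mem_ball, dist_eq_norm]
  constructor
  · rintro ⟨hz, hsq⟩
    have hre : |z.re - S.r| < ρ := by
      have := abs_re_le_norm (z - S.x); rw [sub_re, x_re] at this; exact this.trans_lt hz
    have him : |z.im - S.a| < ρ := by
      have := abs_im_le_norm (z - S.x); rw [sub_im, x_im] at this; exact this.trans_lt hz
    rw [sqn, lt_max_iff] at hsq
    rcases hsq with h | h
    · -- `|re z| > r` with `re z > r - ρ ≥ 0`
      left
      refine ⟨hz, ?_⟩
      rw [abs_lt] at hre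
      have : 0 < z.re := by linarith
      rwa [abs_of_pos this] at h
    · right
      refine ⟨hz, ?_⟩
      rw [abs_lt] at him
      have : -S.r < z.im := by linarith [S.a_nonneg]
      rcases le_or_gt 0 z.im with h0 | h0
      · rwa [abs_of_nonneg h0] at h
      · rw [abs_of_neg h0] at h; linarith
  · rintro (⟨hz, h⟩ | ⟨hz, h⟩)
    · exact ⟨hz, lt_max_of_lt_left (h.trans_le (le_abs_self _))⟩
    · exact ⟨hz, lt_max_of_lt_right (h.trans_le (le_abs_self _))⟩

/-- A point just north-east of the top-right corner, inside `ball x ρ` when the ball reaches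
above the top side. [folklore] -/
theorem exists_corner_point {ρ : ℝ} (hρ0 : 0 < ρ) (h : (ball S.x ρ ∩ {z : ℂ | S.r < z.im}).Nonempty) :
    ∃ w ∈ ball S.x ρ, S.r < w.re ∧ S.r < w.im := by
  obtain ⟨z, hz, hzim⟩ := h
  rw [mem_ball, dist_eq_norm] at hz
  have him : |z.im - S.a| < ρ := by
    have := abs_im_le_norm (z - S.x); rw [sub_im, x_im] at this; exact this.trans_lt hz
  have hgap : S.r - S.a < ρ := by
    rw [abs_lt] at him; rw [mem_setOf_eq] at hzim; linarith
  -- `w = x + δ + (r - a + δ) i` with `δ` small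
  obtain ⟨δ, hδ0, hδ⟩ : ∃ δ > 0, δ ^ 2 + (S.r - S.a + δ) ^ 2 < ρ ^ 2 := by
    have hcont : ContinuousAt (fun δ : ℝ ↦ δ ^ 2 + (S.r - S.a + δ) ^ 2) 0 := by fun_prop
    have hlt : (0 : ℝ) ^ 2 + (S.r - S.a + 0) ^ 2 < ρ ^ 2 := by
      have h1 : 0 ≤ S.r - S.a := by linarith [S.a_le]
      nlinarith
    have hev := hcont.eventually (gt_mem_nhds hlt)
    obtain ⟨δ', hδ', hδ'pos⟩ := ((hev.filter_mono (nhdsWithin_le_nhds (s := Ioi (0 : ℝ)))).and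
      (self_mem_nhdsWithin (a := (0 : ℝ)) (s := Ioi 0))).exists
    exact ⟨δ', hδ'pos, hδ'⟩
  refine ⟨S.x + (δ : ℂ) + ((S.r - S.a + δ : ℝ) : ℂ) * I, ?_, ?_, ?_⟩
  · rw [mem_ball, dist_eq_norm, show S.x + (δ : ℂ) + ((S.r - S.a + δ : ℝ) : ℂ) * I - S.x =
      (δ : ℂ) + ((S.r - S.a + δ : ℝ) : ℂ) * I by ring]
    rw [← sq_lt_sq₀ (norm_nonneg _) hρ0.le, Complex.sq_norm, Complex.normSq_apply]
    simp
    nlinarith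
  · simp [x_re]; exact hδ0
  · simp [x_im]; linarith

/-- **`ball x ρ ∩ {sqn > r}` is preconnected** (`0 < ρ ≤ r`). [folklore] -/
theorem isPreconnected_ball_inter_sqn_gt {ρ : ℝ} (hρ0 : 0 < ρ) (hρ : ρ ≤ S.r) :
    IsPreconnected (ball S.x ρ ∩ {z | S.r < sqn z}) := by
  rw [S.ball_inter_sqn_gt hρ]
  have h1 : IsPreconnected (ball S.x ρ ∩ {z : ℂ | S.r < z.re}) :=
    ((convex_ball _ _).inter (convex_halfSpace_re_gt S.r)).isPreconnected
  have h2 : IsPreconnected (ball S.x ρ ∩ {z : ℂ | S.r < z.im}) :=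
    ((convex_ball _ _).inter (convex_halfSpace_im_gt S.r)).isPreconnected
  rcases (ball S.x ρ ∩ {z : ℂ | S.r < z.im}).eq_empty_or_nonempty with he | hne
  · rw [he, union_empty]; exact h1
  · obtain ⟨w, hw, hwre, hwim⟩ := S.exists_corner_point hρ0 hne
    exact IsPreconnected.union w ⟨hw, hwre⟩ ⟨hw, hwim⟩ h1 h2

/-- **`ball x ρ ∩ ({side < 0} ∪ {sqn > r})` is preconnected** (`0 < ρ ≤ r`): the clockwise
half-ball and the outer region share the points `x + δ - δ i`. [folklore] -/
theorem isPreconnected_ball_inter_side_neg_union {ρ : ℝ} (hρ0 : 0 < ρ) (hρ : ρ ≤ S.r) :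
    IsPreconnected (ball S.x ρ ∩ ({z | S.side z < 0} ∪ {z | S.r < sqn z})) := by
  rw [inter_union_distrib_left]
  set L : ℂ →ₗ[ℝ] ℝ := S.r • Complex.imLm - S.a • Complex.reLm with hL
  have hLside : ∀ z, L z = S.side z := fun z ↦ by simp [hL, side]
  have h1 : IsPreconnected (ball S.x ρ ∩ {z : ℂ | S.side z < 0}) := by
    have : {z : ℂ | S.side z < 0} = {z | L z < 0} := by ext z; rw [mem_setOf_eq, mem_setOf_eq, hLside]
    rw [this]
    exact ((convex_ball _ _).inter (convex_halfSpace_lt L.isLinear 0)).isPreconnected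
  have h2 := S.isPreconnected_ball_inter_sqn_gt hρ0 hρ
  -- common point `w = x + δ - δ i`
  set δ : ℝ := ρ / 2 with hδ
  have hδ0 : 0 < δ := by positivity
  set w : ℂ := S.x + (δ : ℂ) - (δ : ℂ) * I with hw
  have hwball : w ∈ ball S.x ρ := by
    rw [mem_ball, dist_eq_norm, show w - S.x = (δ : ℂ) - (δ : ℂ) * I by rw [hw]; ring,
      ← sq_lt_sq₀ (norm_nonneg _) hρ0.le, Complex.sq_norm, Complex.normSq_apply]
    simp
    nlinarith
  have hwside : S.side w < 0 := by
    rw [hw, side]; simp [x_re, x_im]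
    nlinarith [S.r_pos, S.a_nonneg]
  have hwsqn : S.r < sqn w := by
    refine lt_max_of_lt_left ?_
    rw [hw]; simp [x_re]
    rw [abs_of_pos (by linarith [S.r_pos])]; linarith
  exact IsPreconnected.union w ⟨hwball, hwside⟩ ⟨hwball, hwsqn⟩ h1 h2

/-- **`ball x ρ ∩ ({side > 0} ∪ {sqn > r})` is preconnected** (`0 < ρ ≤ r`): common points
`x + δ + 2δ i`. [folklore] -/
theorem isPreconnected_ball_inter_side_pos_union {ρ : ℝ} (hρ0 : 0 < ρ) (hρ : ρ ≤ S.r) :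
    IsPreconnected (ball S.x ρ ∩ ({z | 0 < S.side z} ∪ {z | S.r < sqn z})) := by
  rw [inter_union_distrib_left]
  set L : ℂ →ₗ[ℝ] ℝ := S.r • Complex.imLm - S.a • Complex.reLm with hL
  have hLside : ∀ z, L z = S.side z := fun z ↦ by simp [hL, side]
  have h1 : IsPreconnected (ball S.x ρ ∩ {z : ℂ | 0 < S.side z}) := by
    have : {z : ℂ | 0 < S.side z} = {z | 0 < L z} := by ext z; rw [mem_setOf_eq, mem_setOf_eq, hLside]
    rw [this]
    exact ((convex_ball _ _).inter (convex_halfSpace_gt L.isLinear 0)).isPreconnected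
  have h2 := S.isPreconnected_ball_inter_sqn_gt hρ0 hρ
  set δ : ℝ := ρ / 4 with hδ
  have hδ0 : 0 < δ := by positivity
  set w : ℂ := S.x + (δ : ℂ) + ((2 * δ : ℝ) : ℂ) * I with hw
  have hwball : w ∈ ball S.x ρ := by
    rw [mem_ball, dist_eq_norm, show w - S.x = (δ : ℂ) + ((2 * δ : ℝ) : ℂ) * I by rw [hw]; ring,
      ← sq_lt_sq₀ (norm_nonneg _) hρ0.le, Complex.sq_norm, Complex.normSq_apply]
    simp
    nlinarith
  have hwside : 0 < S.side w := by
    rw [hw, side]; simp [x_re, x_im]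
    nlinarith [S.r_pos, S.a_nonneg, S.a_le]
  have hwsqn : S.r < sqn w := by
    refine lt_max_of_lt_left ?_
    rw [hw]; simp [x_re]
    rw [abs_of_pos (by linarith [S.r_pos])]; linarith
  exact IsPreconnected.union w ⟨hwball, hwside⟩ ⟨hwball, hwsqn⟩ h1 h2

/-- `ball x ρ ∩ {sqn < r}` is convex, hence preconnected. [folklore] -/
theorem isPreconnected_ball_inter_sqn_lt (ρ : ℝ) :
    IsPreconnected (ball S.x ρ ∩ {z | sqn z < S.r}) := by
  exact ((convex_ball _ _).inter (convex_sqn_lt S.r)).isPreconnected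

/-- **Covering off the gate set**: every point of `ball x ρ ∖ G` (`ρ ≤ r`) has `sqn ≠ r` and,
if `sqn < r`, `side ≠ 0`. [folklore] -/
theorem side_ne_zero_of_notMem_G {ρ : ℝ} (hρ : ρ ≤ S.r) {z : ℂ} (hz : z ∈ ball S.x ρ)
    (hzG : z ∉ S.G) (hsq : sqn z < S.r) : S.side z ≠ 0 := by
  intro h0
  apply hzG
  left
  -- `z` is on the line through `0` and `x`, inside `Q'`, near `x`: it is `t x` with `0 < t < 1`
  rw [S.mem_segment_iff]
  -- solve `z = t x`: `t = re z / r`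
  set t : ℝ := z.re / S.r with ht
  have hr := S.r_pos
  have hre : z.re = t * S.r := by rw [ht]; field_simp
  have him : z.im = t * S.a := by
    rw [side] at h0
    have : S.r * z.im = S.a * z.re := by linarith
    rw [hre] at this
    have : S.r * z.im = S.r * (t * S.a) := by rw [this]; ring
    exact mul_left_cancel₀ hr.ne' this
  have hzeq : z = (t : ℂ) * S.x := by
    apply Complex.ext
    · rw [re_ofReal_mul, x_re, hre]
    · rw [im_ofReal_mul, x_im, him]
  refine ⟨t, ⟨?_, ?_⟩, hzeq⟩
  · -- `t > 0` since `re z > r - ρ ≥ 0`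
    rw [mem_ball, dist_eq_norm] at hz
    have := abs_re_le_norm (z - S.x); rw [sub_re, x_re, abs_le] at this
    have h1 : 0 ≤ z.re := by linarith [this.1]
    exact div_nonneg h1 hr.le
  · -- `t ≤ 1` since `sqn z < r`
    have h1 : |z.re| < S.r := lt_of_le_of_lt (le_max_left _ _) hsq
    rw [hre, abs_lt] at h1
    by_contra hgt
    push Not at hgt
    nlinarith

end Setup

end ThreeChamber

end Literature.Analysis.Complex
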